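import Literature.LinearAlgebra.AdjointEigenspaceDuality
import Mathlib.Algebra.Module.Torsion.Basic
import Mathlib.LinearAlgebra.Isomorphisms
import Mathlib.Algebra.Ring.NonZeroDivisors
import HarnessLib

/-!
# The orthogonal of the common eigenspace is the saturation of the co-eigen image

Topic `LinearAlgebra`; sequel to `AdjointEigenspaceDuality.lean` (same notation: `B : V × W → R` bilinear, adjoint families
`(T_i) ↔ (T'_i)` with eigenvalues `a_i`, `V[𝔭] = ⨅ i, (T i).eigenspace (a i)`, `𝔭'W = ⨆ i, range (T' i − a i • 1)`, right
orthogonal `S^⊥ = (S.map B).dualCoannihilator`, left orthogonal `N^⊥ = (N.map B.flip).dualCoannihilator`). Theorems and one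
definition WITH BODY (a linear equivalence); no named fact; sorry-free.

That file proves `(𝔭'W)^⊥ = V[𝔭]` (exact annihilator), the perfect duality `V[𝔭] × W⧸V[𝔭]^⊥ → R` over a PID, and
`V[𝔭]^⊥ = 𝔭'W` over a field, leaving the INTEGRAL identification of `W ⧸ V[𝔭]^⊥` on paper. Here it is closed, without base
change: for any submodule `N ≤ W` write `sat N := {w | ∃ c ∈ R⁰, c • w ∈ N}` (`= comap N.mkQ (torsion R (W ⧸ N))`,
`mem_comap_mkQ_torsion_iff`). Then
* `N^⊥ = (sat N)^⊥` over any commutative ring (`dualCoannihilator_map_flip_comap_mkQ_torsion`: the values of `B` lie in `R`,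
  on which non-zero-divisors cancel);
* DOUBLE ORTHOGONAL (`dualCoannihilator_map_dualCoannihilator_map_flip`): if `B` is left-surjective (`V → W^∨` onto) and `W ⧸ N` is
  projective, then `(N^⊥)^⊥ = N` — Ebeling's «`(Λ^⊥)^⊥ = Λ`» for a primitive sublattice of a unimodular lattice
  [Ebeling 1994, §1.1, proof of Prop. 1.2], proved through «the dual of a projective module separates points»
  (`Module.forall_dual_apply_eq_zero_iff`), no complement chosen;
* over a PID with `W` finite: `W ⧸ sat N` is torsion-free (`isTorsionFree_quotient_comap_mkQ_torsion`, any domain) hence free,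
  so for `B` perfect `V[𝔭]^⊥ = ((𝔭'W)^⊥)^⊥ = ((sat 𝔭'W)^⊥)^⊥ = sat 𝔭'W`
  (`dualCoannihilator_map_iInf_eigenspace_eq_comap_torsion`, membership form
  `mem_dualCoannihilator_map_iInf_eigenspace_iff`: `B(V[𝔭], w) = 0 ↔ ∃ c ∈ R⁰, c • w ∈ 𝔭'W`), and
  `W ⧸ V[𝔭]^⊥ ≃ (W ⧸ 𝔭'W) ⧸ torsion` (`quotDualCoannihilatorEquivQuotTorsion`): the module in perfect duality with `V[𝔭]`
  (`isPerfPair_restrictQuotPairing_iInf_eigenspace` of the previous file) IS the torsion-free quotient of the maximal co-eigen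
  quotient `W ⧸ 𝔭'W` — «the `𝒪_𝔓`-lattice in `M_{L_𝔓}(f)^*` generated by the image of the integral étale cohomology»
  [Kings–Loeffler–Zerbes 2017, §2.8, the paragraph before Rem. 2.8.2], i.e. the readers' `T₀`.

## Why this file (application; documentary, nothing here depends on it)

Completes the kernel form of the `bsd-litref` cell's reader step «`(𝔭H)^⊥ = H[𝔭†]`, so `T^{sub} := H¹(X, 𝒪_λ)[𝔭†]` and
`T₀ := im(H¹(X₁(N), 𝒪_λ) → V)` are in PERFECT duality» (`pub/bsd-litref/cgs25/sheets/D-AUDIT-cgs25-r2-ADDENDUM-1.md` §E (iii);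
reader 1's F.2 in `D-AUDIT-cgs25-r1-ADDENDUM-2.md`), part of the in-cell repair of Burungale–Skinner–Tian–Wan arXiv:2409.01350v2
(PREPRINT) Part I l.4175–4176 admitted by referee C4 (C4-R3-ADD (c), C4-R5.3 (1)): with `H = W` free of finite rank over the
DVR `𝒪_λ`, `T₀ = (W ⧸ 𝔭'W)⧸torsion = W ⧸ V[𝔭]^⊥`. Nothing here is a statement about modular curves; no census cell moves.

## References

* W. Ebeling, *Lattices and Codes*, Vieweg (1994), §1.1, Prop. 1.2 and its proof («(Λ^⊥)^⊥ = Λ»; primitive = `Γ/Λ` free).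
* G. Kings, D. Loeffler, S. L. Zerbes, *Rankin–Eisenstein classes and explicit reciprocity laws*, Cambridge J. Math. 5 (2017)
  1–122, §2.8 (Def. 2.8.1, the sentence after it, and the definition of `M_{𝒪_𝔓}(f)^*` before Rem. 2.8.2; arXiv p. 23–24).
-/

namespace Literature.LinearAlgebra

open Function Submodule Module
open scoped nonZeroDivisors

section Saturation

variable {R : Type*} [CommRing R]
variable {V W : Type*} [AddCommGroup V] [Module R V] [AddCommGroup W] [Module R W]

/-- The SATURATION `sat N = comap N.mkQ (torsion (W ⧸ N))` of a submodule: `w ∈ sat N ↔ ∃ c ∈ R⁰, c • w ∈ N`.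
[cite: Ebeling1994, §1.1, before Prop. 1.2 («A sublattice Λ of Γ is called primitive if Γ/Λ is a free ℤ-module»; sat Λ = Λ iff Γ/Λ torsion-free)] -/
theorem mem_comap_mkQ_torsion_iff (N : Submodule R W) (w : W) :
    w ∈ (torsion R (W ⧸ N)).comap N.mkQ ↔ ∃ c : R⁰, (c : R) • w ∈ N := by
  rw [Submodule.mem_comap, Submodule.mkQ_apply, mem_torsion_iff]
  refine exists_congr fun c => ?_
  rw [Submonoid.smul_def, ← Submodule.Quotient.mk_smul, Submodule.Quotient.mk_eq_zero]

/-- `N ≤ sat N`. [cite: Ebeling1994, §1.1, before Prop. 1.2 (primitive sublattices)] -/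
theorem le_comap_mkQ_torsion (N : Submodule R W) : N ≤ (torsion R (W ⧸ N)).comap N.mkQ :=
  fun w hw => (mem_comap_mkQ_torsion_iff N w).mpr ⟨1, by rwa [OneMemClass.coe_one, one_smul]⟩

/-- **Orthogonals do not see saturation**: `(sat N)^⊥ = N^⊥` for every bilinear `B : V × W → R` — if `B(v, N) = 0` and
`c • w ∈ N` with `c` a non-zero-divisor, then `c · B(v, w) = 0`, so `B(v, w) = 0`. [cite: Ebeling1994, §1.1, proof of Prop. 1.2 («Since Λ is primitive, the same is true for Λ^⊥, as one can easily see»)] -/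
theorem dualCoannihilator_map_flip_comap_mkQ_torsion (B : V →ₗ[R] W →ₗ[R] R) (N : Submodule R W) :
    (((torsion R (W ⧸ N)).comap N.mkQ).map B.flip).dualCoannihilator = (N.map B.flip).dualCoannihilator := by
  refine le_antisymm (fun v hv => ?_) (fun v hv => ?_)
  · rw [mem_dualCoannihilator_map_iff] at hv ⊢
    exact fun n hn => hv n (le_comap_mkQ_torsion N hn)
  · rw [mem_dualCoannihilator_map_iff] at hv ⊢
    intro w hw
    obtain ⟨c, hc⟩ := (mem_comap_mkQ_torsion_iff N w).mp hw
    have h : (c : R) • B.flip w v = 0 := by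
      rw [← LinearMap.smul_apply, ← map_smul]
      exact hv _ hc
    exact ((isRegular_iff_mem_nonZeroDivisors.mpr c.2).smul_eq_zero_iff_right).mp h

/-- **Double orthogonal.** If `B : V × W → R` is LEFT-SURJECTIVE (every functional on `W` is a `B(v, −)`) and `W ⧸ N` is
projective, then `(N^⊥)^⊥ = N`: for `w ∈ (N^⊥)^⊥` every functional `ψ` on `W ⧸ N` kills `[w]` (write `ψ ∘ mkQ = B(v, −)`,
then `v ∈ N^⊥`), and the dual of a projective module separates points. Ebeling: «`(Λ^⊥)^⊥ = Λ`» for `Λ` primitive in a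
unimodular `Γ`. [cite: Ebeling1994, §1.1, proof of Prop. 1.2 («Moreover, (Λ^⊥)^⊥ = Λ»)] -/
theorem dualCoannihilator_map_dualCoannihilator_map_flip (B : V →ₗ[R] W →ₗ[R] R) (hB : Surjective B)
    (N : Submodule R W) [Module.Projective R (W ⧸ N)] :
    (((N.map B.flip).dualCoannihilator).map B).dualCoannihilator = N := by
  refine le_antisymm (fun w hw => ?_) (fun n hn => ?_)
  · rw [mem_dualCoannihilator_map_iff] at hw
    rw [← Submodule.Quotient.mk_eq_zero N, ← Module.forall_dual_apply_eq_zero_iff R]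
    intro ψ
    obtain ⟨v, hv⟩ := hB (ψ ∘ₗ N.mkQ)
    have hvN : v ∈ (N.map B.flip).dualCoannihilator := by
      rw [mem_dualCoannihilator_map_iff]
      intro n hn
      rw [LinearMap.flip_apply, hv, LinearMap.comp_apply, Submodule.mkQ_apply,
        (Submodule.Quotient.mk_eq_zero N).mpr hn, map_zero]
    have h := hw v hvN
    rwa [hv] at h
  · rw [mem_dualCoannihilator_map_iff]
    intro v hv
    rw [mem_dualCoannihilator_map_iff] at hv
    have h := hv n hn
    rwa [LinearMap.flip_apply] at h

/-- `W ⧸ sat N` is torsion-free over a domain (it is `(W ⧸ N) ⧸ torsion`). [cite: Ebeling1994, §1.1, before Prop. 1.2 (primitive sublattices: Γ/Λ free)] -/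
theorem isTorsionFree_quotient_comap_mkQ_torsion [IsDomain R] (N : Submodule R W) :
    Module.IsTorsionFree R (W ⧸ (torsion R (W ⧸ N)).comap N.mkQ) := by
  have hmap : ((torsion R (W ⧸ N)).comap N.mkQ).map N.mkQ = torsion R (W ⧸ N) :=
    Submodule.map_comap_eq_of_surjective (Submodule.mkQ_surjective N) _
  let e : ((W ⧸ N) ⧸ torsion R (W ⧸ N)) ≃ₗ[R] W ⧸ (torsion R (W ⧸ N)).comap N.mkQ :=
    (Submodule.quotEquivOfEq _ _ hmap).symm.trans
      (Submodule.quotientQuotientEquivQuotient N _ (le_comap_mkQ_torsion N))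
  exact e.symm.injective.moduleIsTorsionFree _ fun r m => map_smul _ r m

/-- The quotient `W ⧸ sat N` as `(W ⧸ N) ⧸ torsion`, explicitly. [cite: Ebeling1994, §1.1, before Prop. 1.2 (primitive sublattices: Γ/Λ free)] -/
def quotComapMkQTorsionEquiv (N : Submodule R W) :
    (W ⧸ (torsion R (W ⧸ N)).comap N.mkQ) ≃ₗ[R] (W ⧸ N) ⧸ torsion R (W ⧸ N) :=
  ((Submodule.quotEquivOfEq _ _ (Submodule.map_comap_eq_of_surjective (Submodule.mkQ_surjective N)
      (torsion R (W ⧸ N)))).symm.trans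
    (Submodule.quotientQuotientEquivQuotient N _ (le_comap_mkQ_torsion N))).symm

end Saturation

section PID

variable {R : Type*} [CommRing R] [IsDomain R] [IsPrincipalIdealRing R]
variable {V W : Type*} [AddCommGroup V] [Module R V] [AddCommGroup W] [Module R W]

/-- **`V[𝔭]^⊥ = sat(𝔭'W)` over a PID.** `W` finite over a PID, `B : V × W → R` perfect, `(T_i) ↔ (T'_i)` adjoint: the
right orthogonal of the common eigenspace is EXACTLY the saturation of the co-eigen image —
`V[𝔭]^⊥ = ((𝔭'W)^⊥)^⊥ = ((sat 𝔭'W)^⊥)^⊥ = sat 𝔭'W` (exact annihilator; saturation-blindness; double orthogonal, `W ⧸ sat`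
being torsion-free hence free). [cite: Ebeling1994, §1.1, proof of Prop. 1.2 («(Λ^⊥)^⊥ = Λ» for Λ primitive in Γ unimodular); applied to the saturation of the co-eigen sublattice] -/
theorem dualCoannihilator_map_iInf_eigenspace_eq_comap_torsion [Module.Finite R W] (B : V →ₗ[R] W →ₗ[R] R)
    [B.IsPerfPair] {ι : Type*} {T : ι → Module.End R V} {T' : ι → Module.End R W}
    (hadj : ∀ i v w, B (T i v) w = B v (T' i w)) (a : ι → R) :
    ((⨅ i, (T i).eigenspace (a i)).map B).dualCoannihilator
      = (torsion R (W ⧸ ⨆ i, LinearMap.range (T' i - a i • (1 : Module.End R W)))).comap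
          (⨆ i, LinearMap.range (T' i - a i • (1 : Module.End R W))).mkQ := by
  have hB : B.SeparatingLeft := fun v hv =>
    (LinearMap.IsPerfPair.bijective_left B).1 (by ext w; rw [hv w, map_zero, LinearMap.zero_apply])
  haveI := isTorsionFree_quotient_comap_mkQ_torsion (W := W)
    (⨆ i, LinearMap.range (T' i - a i • (1 : Module.End R W)))
  rw [← dualCoannihilator_map_flip_iSup_range B hB hadj a, ← dualCoannihilator_map_flip_comap_mkQ_torsion B]
  exact dualCoannihilator_map_dualCoannihilator_map_flip B (LinearMap.IsPerfPair.bijective_left B).2 _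

/-- Membership form: `B(V[𝔭], w) = 0 ↔ ∃ c ∈ R⁰, c • w ∈ 𝔭'W`. [cite: Ebeling1994, §1.1, proof of Prop. 1.2 («(Λ^⊥)^⊥ = Λ»); applied to the saturation of the co-eigen sublattice] -/
theorem mem_dualCoannihilator_map_iInf_eigenspace_iff [Module.Finite R W] (B : V →ₗ[R] W →ₗ[R] R)
    [B.IsPerfPair] {ι : Type*} {T : ι → Module.End R V} {T' : ι → Module.End R W}
    (hadj : ∀ i v w, B (T i v) w = B v (T' i w)) (a : ι → R) (w : W) :
    w ∈ ((⨅ i, (T i).eigenspace (a i)).map B).dualCoannihilator ↔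
      ∃ c : R⁰, (c : R) • w ∈ ⨆ i, LinearMap.range (T' i - a i • (1 : Module.End R W)) := by
  rw [dualCoannihilator_map_iInf_eigenspace_eq_comap_torsion B hadj a, mem_comap_mkQ_torsion_iff]

/-- **The partner of `V[𝔭]` is the torsion-free co-eigen quotient**: `W ⧸ V[𝔭]^⊥ ≃ (W ⧸ 𝔭'W) ⧸ torsion` — the module in
perfect duality with the common eigenspace (`isPerfPair_restrictQuotPairing_iInf_eigenspace`) is the maximal co-eigen
quotient modulo its torsion, i.e. the lattice generated by the image of `W` in `(W ⧸ 𝔭'W) ⊗ Frac R`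
(`M_𝒪(f)^*` ⊂ `M_L(f)^*`). [cite: KingsLoefflerZerbes2017, §2.8, definition of M_{𝒪_𝔓}(f)^* before Rem. 2.8.2 («the 𝒪_𝔓-lattice in M_{L_𝔓}(f)^* generated by the image of the integral étale cohomology») with the sentence after Def. 2.8.1 («well-defined (and perfect)»)] -/
def quotDualCoannihilatorEquivQuotTorsion [Module.Finite R W] (B : V →ₗ[R] W →ₗ[R] R) [B.IsPerfPair]
    {ι : Type*} (T : ι → Module.End R V) (T' : ι → Module.End R W)
    (hadj : ∀ i v w, B (T i v) w = B v (T' i w)) (a : ι → R) :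
    (W ⧸ ((⨅ i, (T i).eigenspace (a i)).map B).dualCoannihilator) ≃ₗ[R]
      (W ⧸ ⨆ i, LinearMap.range (T' i - a i • (1 : Module.End R W))) ⧸
        torsion R (W ⧸ ⨆ i, LinearMap.range (T' i - a i • (1 : Module.End R W))) :=
  (Submodule.quotEquivOfEq _ _ (dualCoannihilator_map_iInf_eigenspace_eq_comap_torsion B hadj a)).trans
    (quotComapMkQTorsionEquiv _)

end PID

end Literature.LinearAlgebra
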